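import Literature.Probability.LatticeModels.DiscreteGreenKernelConvergence
import Literature.Probability.LatticeModels.MeshDomainBulk
import Literature.Probability.LatticeModels.HoleFreePotential
import Literature.Probability.RandomPlanarGeometry.JordanBoundaryLemmas
import Literature.Probability.RandomPlanarGeometry.JordanDomainInterior
import Literature.Probability.RandomPlanarGeometry.ChordalLERWScalingLimit
import Summits.CriticalPhenomena.SAWScalingLimit.Theorems.SAWLoopFugacityFlowAvoidanceLimitGreenConvergenceInnerKernel
import HarnessLib

/-!
# Kernel convergence of the outer lattice approximants of a Jordan domain
— helper of stub `stub_greenConvergence` (GC) of line `symplectic-fermion-anchor`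
(crux `SAWLoopFugacityFlow.AvoidanceLimit`, stmt-CriticalPhenomena-10649; lead c2 GC-sandwich
programme, brick W-F)

**What.** Fix a Jordan domain `D'` and a base point `zs ∈ D'`. At mesh `δ` let
`V'_δ = {w | δw ∈ closure D'}` be the lattice points of the closed domain; a site `g` *escapes*
when for every height `M` a chain of face steps avoiding `V'_δ` (`FaceStep V'_δ`: nearest-neighbour
steps of `ℤ²` with both endpoints outside `V'_δ`) joins `g` to a site of second coordinate `≥ M`;
the *outer approximant* (hole-fill) is `NE_δ = {g | g does not escape} ⊇ V'_δ`, and `C_δ` is the set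
of sites reachable from the base site `nearestSite δ zs` in `ChordalLERW.siteGraph NE_δ`. The two
registered signatures of brick W-F:
* `eventually_mem_outerComponent`: for a compact `K ⊆ D'`, for all small `δ > 0` every site whose
  mesh point lies in `K` belongs to `C_δ`;
* `kernelConvergence_outer`: the polygonal domains `δ • starDomain C_δ` converge to `D'` in the
  kernel (Carathéodory) sense `ChelkakSmirnov.KernelConvergence`.

**Proof.** *Membership.* The points of `K` are joined to `zs` by paths of `D'` at distance `> η`
from `∂D'` (`JordanDomain.exists_joined_far_of_isCompact`); for `3δ ≤ η` a site whose mesh point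
is within `3δ` of such a path has its mesh point in `D' ⊆ closure D'`, so lies in `V'_δ ⊆ NE_δ`
(a chain of face steps issued from a point of `V'_δ` is trivial). *Local step*
(`reachable_of_dist_lt`): two sites with mesh points `r`-close to a point `p` are joined by a
two-leg lattice path inside the ball `B(p, 2r)`. *Along a path* (`reachable_nearestSite_of_path'`):
the relation "the nearest sites of `γ s`, `γ t` are joined" is then open on `[0, 1]`, hence total
(`PreconnectedSpace.induction₂'`). Kernel convergence (i) follows as for the inner approximants
(brick W-D, `…GreenConvergenceInnerKernel`). (ii): *exterior points are eventually outside
`U_δ = δ • starDomain C_δ`* (`eventually_notMem_smul_starDomain_outer`): the exterior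
`E = (closure D')ᶜ` is open, connected and unbounded (Jordan curve theorem,
`JordanDomain.exterior_of_JCT`), hence path connected; join `e ∈ E` inside `E` to a far point
`R + 2` of the real axis (`closure D' ⊆ closedBall 0 R`) by a path `γ` at distance `> η'` from
`closure D'`. If `e ∈ U_δ` for a small `δ`, then `e` lies in the open star of a site `x ∈ C_δ ⊆ NE_δ`
(the base site is in `V'_δ` for small `δ`); but `x` escapes — to the nearest site of `e`, then
along `γ` (chains of face steps avoiding `V'_δ` are the walks of `siteGraph V'_δᶜ`), then straight
up the column above the nearest site of the far point, whose mesh points have real part `> R` —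
a contradiction. Finally, for `a ∈ ∂D'` pick `z ∈ D'` and `e ∈ E` within `ρ/2` of `a`
(`JordanDomain.frontier_subset_closure_exterior`); for small `δ`, `z` is interior to `U_δ` by (i)
and `e ∉ U_δ`, so the connected segment `[z, e] ⊆ ball a ρ` meets `∂U_δ`. Folklore; nothing from
the literature asserted.
-/

noncomputable section

open scoped BigOperators Topology Pointwise
open Filter Finset
open Literature.Probability.RandomPlanarGeometry Literature.Probability.LatticeModels

namespace Summit.CriticalPhenomena.SAWScalingLimit.Theorems.AvoidanceLimit.Anchor

namespace OuterKernel

open InnerKernel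

/-- **Local step.** If every site whose mesh point is within `2r` of `p` lies in `A`, then two
sites whose mesh points are within `r` of `p` are joined in `ChordalLERW.siteGraph A` (a two-leg
lattice path in the rectangle they span, which lies in the ball of radius `2r` about `p`).
[folklore] -/
theorem reachable_of_dist_lt {A : Set (Site 2)} {δ r : ℝ} (hδ : 0 < δ) {p : ℂ}
    (hp : ∀ v : Site 2, dist (meshPoint δ v) p < 2 * r → v ∈ A) {w z : Site 2}
    (hw : dist (meshPoint δ w) p < r) (hz : dist (meshPoint δ z) p < r) :
    (ChordalLERW.siteGraph A).Reachable w z :=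
  siteGraph_reachable_of_forall_mem w z fun v hv =>
    hp v (Metric.mem_ball.1 (rectangle_subset_ball hw hz (meshPoint_mem_rectangle hδ.le hv)))

/-- **Along a path.** If every site whose mesh point is within `3δ` of the path `γ` lies in `A`,
then the nearest sites of the endpoints of `γ` are joined in `ChordalLERW.siteGraph A`: the
relation "the nearest sites of `γ s` and `γ t` are joined" is open on `[0, 1]` by the local step,
hence total (`PreconnectedSpace.induction₂'`). [folklore] -/
theorem reachable_nearestSite_of_path' {A : Set (Site 2)} {δ : ℝ} (hδ : 0 < δ) {x y : ℂ}
    (γ : Path x y) (hγ : ∀ t, ∀ v : Site 2, dist (meshPoint δ v) (γ t) < 3 * δ → v ∈ A) :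
    (ChordalLERW.siteGraph A).Reachable (nearestSite δ x) (nearestSite δ y) := by
  set G := ChordalLERW.siteGraph A with hG
  have key : ∀ s t : unitInterval, G.Reachable (nearestSite δ (γ s)) (nearestSite δ (γ t)) := by
    intro s₀ t₀
    refine PreconnectedSpace.induction₂'
      (fun s t : unitInterval => G.Reachable (nearestSite δ (γ s)) (nearestSite δ (γ t)))
      (fun s => ?_) ⟨fun a b c hab hbc => hab.trans hbc⟩ s₀ t₀
    have hcont : ContinuousAt γ s := γ.continuous.continuousAt
    filter_upwards [hcont (Metric.ball_mem_nhds (γ s) (by positivity : (0 : ℝ) < δ / 4))]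
      with t ht
    have h1 : dist (meshPoint δ (nearestSite δ (γ s))) (γ s) < 5 / 4 * δ :=
      (dist_meshPoint_nearestSite_le hδ (γ s)).trans_lt (by linarith)
    have h2 : dist (meshPoint δ (nearestSite δ (γ t))) (γ s) < 5 / 4 * δ :=
      calc dist (meshPoint δ (nearestSite δ (γ t))) (γ s)
          ≤ dist (meshPoint δ (nearestSite δ (γ t))) (γ t) + dist (γ t) (γ s) :=
            dist_triangle _ _ _
        _ < δ + δ / 4 :=
            add_lt_add_of_le_of_lt (dist_meshPoint_nearestSite_le hδ (γ t)) (Metric.mem_ball.1 ht)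
        _ = 5 / 4 * δ := by ring
    have h : G.Reachable (nearestSite δ (γ s)) (nearestSite δ (γ t)) :=
      reachable_of_dist_lt hδ (fun v hv => hγ s v (by linarith)) h1 h2
    exact ⟨h, h.symm⟩
  simpa only [γ.source, γ.target] using key 0 1

/-- Chains of face steps avoiding `P` are the walks of `ChordalLERW.siteGraph Pᶜ`. [folklore] -/
theorem faceChain_iff_reachable {P : Set (Site 2)} {a b : Site 2} :
    Relation.ReflTransGen (FaceStep P) a b ↔ (ChordalLERW.siteGraph Pᶜ).Reachable a b := by
  have h : (ChordalLERW.siteGraph Pᶜ).Adj = FaceStep P := by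
    ext x y
    simp only [ChordalLERW.siteGraph_adj_iff, FaceStep, Set.mem_compl_iff]
  rw [SimpleGraph.reachable_iff_reflTransGen, h]

/-- A site of `P` does not escape from `P`: a chain of face steps avoiding `P` issued from it is
trivial, so never exceeds its own height. [folklore] -/
theorem not_escaping_of_mem {P : Set (Site 2)} {g : Site 2} (hg : g ∈ P) :
    ¬ ∀ M : ℤ, ∃ g' : Site 2, M ≤ g' 1 ∧ Relation.ReflTransGen (FaceStep P) g g' := by
  intro h
  obtain ⟨g', hM, hpath⟩ := h (g 1 + 1)
  rcases hpath.cases_head with rfl | ⟨c, hc, -⟩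
  · omega
  · exact hc.2.1 hg

/-- **Good sites.** If `p ∈ D'` is at distance `> η ≥ 3δ` from the boundary curve, every site
whose mesh point is within `3δ` of `p` has its mesh point in `D' ⊆ closure D'`, hence does not
escape from `V'_δ = {w | δw ∈ closure D'}`. [folklore] -/
theorem not_escaping_of_dist_lt {D' : JordanDomain} {δ η : ℝ} (hδη : 3 * δ ≤ η)
    {p : ℂ} (hp : p ∈ D'.carrier) (hpη : η < Metric.infDist p (frontier D'.carrier))
    {w : Site 2} (hw : dist (meshPoint δ w) p < 3 * δ) :
    w ∈ {g : Site 2 | ¬ ∀ M : ℤ, ∃ g' : Site 2, M ≤ g' 1 ∧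
      Relation.ReflTransGen (FaceStep {v : Site 2 | meshPoint δ v ∈ closure D'.carrier}) g g'} :=
  not_escaping_of_mem (P := {v : Site 2 | meshPoint δ v ∈ closure D'.carrier})
    (subset_closure (ball_subset_carrier_of_le_infDist D' hp hpη.le
      (Metric.mem_ball.2 (hw.trans_le hδη))))

/-- For all small `δ` the mesh point of the base site `nearestSite δ zs` lies in `D'`.
[folklore] -/
theorem eventually_meshPoint_nearestSite_mem (D' : JordanDomain) {zs : ℂ}
    (hzs : zs ∈ D'.carrier) :
    ∀ᶠ δ in 𝓝[>] (0 : ℝ), meshPoint δ (nearestSite δ zs) ∈ D'.carrier := by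
  filter_upwards [Ioo_mem_nhdsGT (D'.infDist_frontier_pos hzs)] with δ hδ
  exact ball_subset_carrier_of_le_infDist D' hzs le_rfl
    (Metric.mem_ball.2 ((dist_meshPoint_nearestSite_le hδ.1 zs).trans_lt hδ.2))

end OuterKernel

/-- **Compacta are swallowed by the outer component** (brick W-F, registered signature). For a
Jordan domain `D'`, a base point `zs ∈ D'` and a compact `K ⊆ D'`: for all small mesh `δ > 0`,
every site whose mesh point lies in `K` is joined to the base site `nearestSite δ zs` in the site
graph of the outer approximant `NE_δ` (the hole-fill of the lattice points of `closure D'`).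
[folklore] -/
theorem eventually_mem_outerComponent :
    ∀ (D' : JordanDomain) (zs : ℂ) (K : Set ℂ), zs ∈ D'.carrier → IsCompact K → K ⊆ D'.carrier →
      ∀ᶠ δ in 𝓝[>] (0 : ℝ), ∀ u : Site 2, meshPoint δ u ∈ K →
        (ChordalLERW.siteGraph {g : Site 2 | ¬ ∀ M : ℤ, ∃ g' : Site 2, M ≤ g' 1 ∧
          Relation.ReflTransGen (FaceStep {w : Site 2 | meshPoint δ w ∈ closure D'.carrier}) g g'}).Reachable
          (nearestSite δ zs) u := by
  intro D' zs K hzs hK hKD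
  obtain ⟨η, hη, hpath⟩ := D'.exists_joined_far_of_isCompact hzs hK hKD
  filter_upwards [Ioo_mem_nhdsGT (by positivity : (0 : ℝ) < η / 3)] with δ hδ u hu
  obtain ⟨hδ0, hδη⟩ := hδ
  obtain ⟨γ, hγ⟩ := hpath _ hu
  have h := (OuterKernel.reachable_nearestSite_of_path' hδ0 γ fun t v hv =>
    OuterKernel.not_escaping_of_dist_lt (by linarith) (hγ t).1 (hγ t).2 hv).symm
  rwa [nearestSite_meshPoint hδ0.ne'] at h

namespace OuterKernel

open InnerKernel

/-- Part (i) of kernel convergence of the outer approximants: every `z ∈ D'` has a ball which, for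
all small `δ`, lies in the polygonal domain of the outer component (each point of the ball lies in
the open star of its nearest site, whose mesh point is in a fixed compact ball of `D'`).
[folklore] -/
theorem exists_ball_subset_smul_starDomain_outer (D' : JordanDomain) {zs : ℂ}
    (hzs : zs ∈ D'.carrier) {z : ℂ} (hz : z ∈ D'.carrier) :
    ∃ ρ : ℝ, 0 < ρ ∧ ∀ᶠ δ in 𝓝[>] (0 : ℝ), Metric.ball z ρ ⊆
      δ • ChelkakSmirnov.starDomain {x : Site 2 |
        (ChordalLERW.siteGraph {g : Site 2 | ¬ ∀ M : ℤ, ∃ g' : Site 2, M ≤ g' 1 ∧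
          Relation.ReflTransGen (FaceStep {w : Site 2 | meshPoint δ w ∈ closure D'.carrier})
            g g'}).Reachable (nearestSite δ zs) x} := by
  obtain ⟨ε, hε, hεD⟩ := Metric.isOpen_iff.1 D'.isOpen z hz
  refine ⟨ε / 4, by positivity, ?_⟩
  have hK : IsCompact (Metric.closedBall z (ε / 2)) := isCompact_closedBall z (ε / 2)
  have hKD : Metric.closedBall z (ε / 2) ⊆ D'.carrier :=
    (Metric.closedBall_subset_ball (by linarith)).trans hεD
  filter_upwards [eventually_mem_outerComponent D' zs _ hzs hK hKD,
    Ioo_mem_nhdsGT (by positivity : (0 : ℝ) < ε / 4)] with δ hδK hδI w hw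
  obtain ⟨hδ0, hδε⟩ := hδI
  have hu : meshPoint δ (nearestSite δ w) ∈ Metric.closedBall z (ε / 2) := by
    rw [Metric.mem_closedBall]
    calc dist (meshPoint δ (nearestSite δ w)) z
        ≤ dist (meshPoint δ (nearestSite δ w)) w + dist w z := dist_triangle _ _ _
      _ ≤ δ + ε / 4 := add_le_add (dist_meshPoint_nearestSite_le hδ0 w) (Metric.mem_ball.1 hw).le
      _ ≤ ε / 2 := by linarith
  obtain ⟨hre, him⟩ := abs_sub_nearestSite_le hδ0 w
  exact (mem_smul_starDomain_iff hδ0).2 ⟨nearestSite δ w, hδK _ hu, by linarith, by linarith⟩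

/-- **Exterior points are eventually outside the outer polygonal domain.** For
`e ∉ closure D'` and all small `δ`, `e ∉ δ • starDomain C_δ`: otherwise `e` lies in the open star
of a site `x` of the outer component, which lies in `NE_δ` (with the base site), yet `x` escapes —
by face steps avoiding `V'_δ` to the nearest site of `e`, then along a path of the exterior from
`e` to the far point `|R| + 2` of the real axis (`closure D' ⊆ closedBall 0 R`), then straight up.
[folklore] -/
theorem eventually_notMem_smul_starDomain_outer (D' : JordanDomain) {zs : ℂ}
    (hzs : zs ∈ D'.carrier) {e : ℂ} (he : e ∉ closure D'.carrier) :
    ∀ᶠ δ in 𝓝[>] (0 : ℝ), e ∉ δ • ChelkakSmirnov.starDomain {x : Site 2 |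
      (ChordalLERW.siteGraph {g : Site 2 | ¬ ∀ M : ℤ, ∃ g' : Site 2, M ≤ g' 1 ∧
        Relation.ReflTransGen (FaceStep {w : Site 2 | meshPoint δ w ∈ closure D'.carrier})
          g g'}).Reachable (nearestSite δ zs) x} := by
  -- the exterior is open and connected (Jordan curve theorem), hence path connected
  obtain ⟨hEc, -, -⟩ :=
    D'.exterior_of_JCT Literature.Topology.PlaneTopology.JordanCurveTheorem_holds
  have hEo : IsOpen (closure D'.carrier)ᶜ := isClosed_closure.isOpen_compl
  obtain ⟨r₁, hr₁, hr₁E⟩ := Metric.isOpen_iff.1 hEo e he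
  obtain ⟨R, hR⟩ := D'.isBounded.closure.subset_closedBall (0 : ℂ)
  -- a far point of the exterior on the real axis, a path to it inside the exterior, its margin
  set c : ℂ := ((|R| + 2 : ℝ) : ℂ) with hc
  have hcE : c ∈ (closure D'.carrier)ᶜ := Set.mem_compl fun h => by
    have h1 := hR h
    rw [Metric.mem_closedBall, dist_zero_right, hc, Complex.norm_real, Real.norm_eq_abs,
      abs_of_nonneg (by positivity : (0 : ℝ) ≤ |R| + 2)] at h1
    linarith [le_abs_self R]
  obtain ⟨γ, hγE⟩ : ∃ γ : Path e c, ∀ t, γ t ∉ closure D'.carrier :=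
    ⟨_, (((hEo.isConnected_iff_isPathConnected).1 hEc).joinedIn e (Set.mem_compl he) c
      hcE).somePath_mem⟩
  obtain ⟨η, hη, hηγ⟩ := exists_pos_forall_lt_infDist (isCompact_range γ.continuous)
    isClosed_closure (Set.disjoint_left.2 (by rintro _ ⟨t, rfl⟩; exact hγE t))
    ⟨zs, subset_closure hzs⟩
  filter_upwards [eventually_meshPoint_nearestSite_mem D' hzs,
    Ioo_mem_nhdsGT (by positivity : (0 : ℝ) < r₁ / 4),
    Ioo_mem_nhdsGT (by positivity : (0 : ℝ) < η / 4), Ioo_mem_nhdsGT one_pos]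
    with δ hbase h₁ h₂ h₃ heU
  obtain ⟨hδ0, hδr⟩ := h₁
  obtain ⟨-, hδη⟩ := h₂
  obtain ⟨-, hδ1⟩ := h₃
  obtain ⟨x, hxC, hre, him⟩ := (mem_smul_starDomain_iff hδ0).1 heU
  -- `x` does not escape: the base site lies in `V'_δ ⊆ NE_δ` and `x` is in its component ...
  have hxNE := mem_of_siteGraph_reachable
    (not_escaping_of_mem (P := {v : Site 2 | meshPoint δ v ∈ closure D'.carrier})
      (subset_closure hbase)) hxC
  -- ... yet it escapes: to the nearest site of `e`, along `γ`, then straight up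
  refine hxNE fun M => ?_
  obtain ⟨K, hK⟩ : ∃ K : ℕ, M ≤ nearestSite δ c 1 + K := ⟨(M - nearestSite δ c 1).toNat, by omega⟩
  refine ⟨nearestSite δ c + Pi.single (1 : Fin 2) (K : ℤ), by simpa using hK, ?_⟩
  rw [faceChain_iff_reachable]
  rw [abs_sub_comm] at hre him
  refine ((reachable_of_dist_lt hδ0 (r := 2 * δ) (p := e) (fun v hv => ?_) ?_ ?_).trans
    (reachable_nearestSite_of_path' hδ0 γ fun t v hv => ?_)).trans
      (siteGraph_reachable_add_single _ _ 1 K fun j _ => ?_)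
  · -- sites with mesh point within `4δ < r₁` of `e` are outside `closure D'`
    exact Set.mem_compl fun hvD' =>
      Set.notMem_of_mem_compl (hr₁E (Metric.mem_ball.2 (by linarith))) hvD'
  · rw [Complex.dist_eq]
    calc ‖meshPoint δ x - e‖ ≤ |(meshPoint δ x - e).re| + |(meshPoint δ x - e).im| :=
          Complex.norm_le_abs_re_add_abs_im _
      _ = |δ * ((x 0 : ℤ) : ℝ) - e.re| + |δ * ((x 1 : ℤ) : ℝ) - e.im| := by
          simp only [Complex.sub_re, Complex.sub_im, meshPoint_re, meshPoint_im]
      _ < 2 * δ := by linarith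
  · exact (dist_meshPoint_nearestSite_le hδ0 e).trans_lt (by linarith)
  · -- sites with mesh point within `3δ < η` of `γ` are outside `closure D'`
    refine Set.mem_compl fun hvD' => ?_
    have h1 : Metric.infDist (γ t) (closure D'.carrier) ≤ dist (γ t) (meshPoint δ v) :=
      Metric.infDist_le_dist_of_mem hvD'
    have h2 := hηγ (γ t) ⟨t, rfl⟩
    rw [dist_comm] at h1
    linarith
  · -- the column above the nearest site of the far point has real part `> R`
    refine Set.mem_compl fun hjD' => ?_
    have h1 := hR hjD'
    rw [Metric.mem_closedBall, dist_zero_right] at h1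
    have h2 := (Complex.re_le_norm _).trans h1
    rw [meshPoint_re] at h2
    have h3 : (nearestSite δ c + Pi.single (1 : Fin 2) j : Site 2) 0 = nearestSite δ c 0 := by
      simp
    rw [h3] at h2
    obtain ⟨h4, -⟩ := abs_sub_nearestSite_le hδ0 c
    rw [hc, Complex.ofReal_re] at h4
    have h5 := (abs_le.1 h4).2
    linarith [le_abs_self R]

/-- Part (ii) of kernel convergence of the outer approximants: every boundary point `a` of `D'`
is, for every `ρ > 0` and all small `δ`, within `ρ` of the frontier of the polygonal domain `U`
of the outer component: a point `z ∈ D'` with `dist z a < ρ/2` is interior to `U` by part (i), an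
exterior point `e` with `dist e a < ρ/2` is outside `U`
(`eventually_notMem_smul_starDomain_outer`), and the segment `[z, e] ⊆ ball a ρ` crosses the
frontier of `U`. [folklore] -/
theorem frontier_smul_starDomain_outer_near (D' : JordanDomain) {zs : ℂ}
    (hzs : zs ∈ D'.carrier) {a : ℂ} (ha : a ∈ frontier D'.carrier) {ρ : ℝ} (hρ : 0 < ρ) :
    ∀ᶠ δ in 𝓝[>] (0 : ℝ), (frontier (δ • ChelkakSmirnov.starDomain {x : Site 2 |
        (ChordalLERW.siteGraph {g : Site 2 | ¬ ∀ M : ℤ, ∃ g' : Site 2, M ≤ g' 1 ∧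
          Relation.ReflTransGen (FaceStep {w : Site 2 | meshPoint δ w ∈ closure D'.carrier})
            g g'}).Reachable (nearestSite δ zs) x}) ∩ Metric.ball a ρ).Nonempty := by
  -- an interior point `z` and an exterior point `e` near `a`
  obtain ⟨z, hz, hza⟩ :=
    Metric.mem_closure_iff.1 (frontier_subset_closure ha) (ρ / 2) (by positivity)
  obtain ⟨e, he, hea⟩ := Metric.mem_closure_iff.1
    (D'.frontier_subset_closure_exterior Literature.Topology.PlaneTopology.JordanCurveTheorem_holds
      ha) (ρ / 2) (by positivity)
  obtain ⟨ρz, hρz, hevz⟩ := exists_ball_subset_smul_starDomain_outer D' hzs hz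
  filter_upwards [hevz, eventually_notMem_smul_starDomain_outer D' hzs he] with δ hzU heU
  set U : Set ℂ := δ • ChelkakSmirnov.starDomain {x : Site 2 |
        (ChordalLERW.siteGraph {g : Site 2 | ¬ ∀ M : ℤ, ∃ g' : Site 2, M ≤ g' 1 ∧
          Relation.ReflTransGen (FaceStep {w : Site 2 | meshPoint δ w ∈ closure D'.carrier})
            g g'}).Reachable (nearestSite δ zs) x} with hU
  have hzball : z ∈ Metric.ball a ρ := by
    rw [Metric.mem_ball, dist_comm]
    linarith
  have heball : e ∈ Metric.ball a ρ := by
    rw [Metric.mem_ball, dist_comm]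
    linarith
  have hseg : segment ℝ z e ⊆ Metric.ball a ρ := (convex_ball a ρ).segment_subset hzball heball
  by_contra hcon -- else the connected segment `[z, e]` would stay inside `interior U`
  have hzint : z ∈ interior U :=
    mem_interior.2 ⟨Metric.ball z ρz, hzU, Metric.isOpen_ball, Metric.mem_ball_self hρz⟩
  have hsub : segment ℝ z e ⊆ interior U := by
    refine (convex_segment z e).isPreconnected.subset_of_closure_inter_subset isOpen_interior
      ⟨z, left_mem_segment ℝ z e, hzint⟩ ?_
    rintro q ⟨hq1, hq2⟩
    by_contra hq3
    exact hcon ⟨q, ⟨closure_mono interior_subset hq1, hq3⟩, hseg hq2⟩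
  exact heU (interior_subset (hsub (right_mem_segment ℝ z e)))

end OuterKernel

/-- **Kernel convergence of the outer approximants** (brick W-F, registered signature). For a
Jordan domain `D'` and a base point `zs ∈ D'`, the polygonal domains `δ • starDomain C_δ` of the
component `C_δ` of `nearestSite δ zs` in the site graph of the outer approximant `NE_δ` (the
hole-fill of the lattice points of `closure D'`) converge to `D'` in the kernel (Carathéodory)
sense as `δ → 0⁺`. [folklore] -/
theorem kernelConvergence_outer :
    ∀ (D' : JordanDomain) (zs : ℂ), zs ∈ D'.carrier →
      ChelkakSmirnov.KernelConvergence
        (fun δ : ℝ => δ • ChelkakSmirnov.starDomain {x : Site 2 |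
          (ChordalLERW.siteGraph {g : Site 2 | ¬ ∀ M : ℤ, ∃ g' : Site 2, M ≤ g' 1 ∧
            Relation.ReflTransGen (FaceStep {w : Site 2 | meshPoint δ w ∈ closure D'.carrier}) g g'}).Reachable
            (nearestSite δ zs) x})
        D'.carrier := by
  intro D' zs hzs
  exact ⟨fun z hz => OuterKernel.exists_ball_subset_smul_starDomain_outer D' hzs hz,
    fun a ha ρ hρ => OuterKernel.frontier_smul_starDomain_outer_near D' hzs ha hρ⟩

end Summit.CriticalPhenomena.SAWScalingLimit.Theorems.AvoidanceLimit.Anchor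

end
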